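import Literature.AlgebraicGeometry.Deformation.SquareZeroExtensionObstruction
import Literature.AlgebraicGeometry.Modules.SheafHomFunctor
import Literature.AlgebraicGeometry.Modules.SectionsExact
import Summits.HodgeConjecture.HodgeConjecture.Theorems.PadicSemiregularLiftPadicPridhamSemiregularityClosedImmersionModules
import Summits.HodgeConjecture.HodgeConjecture.Theorems.PadicSemiregularLiftPadicPridhamSemiregularityPadicTowerSections
import HarnessLib

/-!
# The conormal sheaf of `X_{n+1} ↪ X_{n+2}` is `j_*𝒪_{X_k}` for a smooth `p`-adic tower (stub G3)

Let `p` be a prime, `k` a perfect field of characteristic `p`, `W = W(k)`, `W_m = W/p^m`, and `𝒳` a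
smooth proper `W`-scheme (`IsSmoothProperModel`) with thickenings `X_m = 𝒳 ×_W Spec W_m`, special
fibre `X_k`, transition map `i : X_{n+1} ⟶ X_{n+2}` (`thickeningMap`) and `j : X_k ⟶ X_{n+1}`
(`specialFibreToThickening`). We prove stub G3 of line `sigma-ob-kzero-additivity` of the crux
`PadicPridhamSemiregularity` (route `PadicSemiregularLift` of `HodgeConjecture`):

  `conormalSheaf i ≅ j_*𝒪_{X_k}`  (`stub_conormalSheaf_thickeningMap`),

where `conormalSheaf i = i^*𝓘`, `𝓘 = ker(i♯ : 𝒪_{X_{n+2}} → i_*𝒪_{X_{n+1}})`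
(`Literature.AlgebraicGeometry.Deformation`). MATHEMATICS: `𝓘 = p^{n+1}𝒪_{X_{n+2}}` and
multiplication by `p^{n+1}` is an isomorphism `𝒪/p ⥲ p^{n+1}𝒪/p^{n+2}𝒪 = 𝓘` — surjective
tautologically, injective because `𝒪_𝒳` is flat over `W` (smoothness is load-bearing: for `𝒳 = Spec k`
the statement fails, `Negative/StubAudit.conormalStep_false_without_torsionFree`); and
`𝒪/p = (j ≫ i)_*𝒪_{X_k}`, so `i^*𝓘 ≅ i^* i_* (j_*𝒪_{X_k}) ≅ j_*𝒪_{X_k}`, `i` being a closed immersion.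

LEAN PROOF, in Mathlib's abelian category of `𝒪_{X_{n+2}}`-modules:
* `ρ : 𝒪 ⟶ i_* j_* 𝒪_{X_k}` (restriction of functions) is an epimorphism (surjective on affine opens:
  `i♯`, `j♯` are, Mathlib `Scheme.Hom.app_surjective`; `epi_of_app_surjective_of_isAffineOpen`);
* `μ = p^{n+1} · 𝟙_𝒪` factors through `𝓘 ↪ 𝒪` (`p^{n+1} = 0` on `X_{n+1}`, (F3)) and kills
  `ker ρ` (on affine opens `ker ρ ⊆ (p) + (p^{n+1})` by (F1), (F2), and `p^{n+2} = 0`; equality of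
  morphisms is tested on affine opens, `hom_ext_of_isAffineOpen`), so it descends along the
  epimorphism `ρ` to `ν : i_* j_* 𝒪_{X_k} ⟶ 𝓘` (Mathlib `Abelian.epiDesc`);
* `ν` is bijective on affine opens — surjective by (F1) (`ker i♯ ⊆ (p^{n+1})`), injective by the
  flatness input (F4) (`p^{n+1} b = 0 ⟹ b ∈ (p)`) and `p = 0` on `X_k` — hence an isomorphism
  (`isIso_of_app_bijective_of_isAffineOpen`); sections of `𝓘 = ker` are computed by
  `Literature.AlgebraicGeometry.Modules.SectionsExact`;
* finally `i^*(i_* N) ≅ N` for the closed immersion `i` (`isIso_counit_app_of_isClosedImmersion`,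
  helper file `…ClosedImmersionModules`); the section-level facts (F1)–(F4) are in the helper file
  `…PadicTowerSections`.

Everything is proved; no definitions (`ρ` is a local notation, `μ` a `kernel.lift`).
-/

noncomputable section

-- the mandated namespace `Summit.HodgeConjecture.HodgeConjecture.…` repeats a component
set_option linter.dupNamespace false

open CategoryTheory CategoryTheory.Limits AlgebraicGeometry Opposite
  Literature.AlgebraicGeometry.Motives Literature.AlgebraicGeometry.Motives.WittScheme
  Literature.AlgebraicGeometry.Deformation Literature.AlgebraicGeometry.Modules

universe u

namespace Summit.HodgeConjecture.HodgeConjecture.Theorems.PadicPridhamSemiregularity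

section Ideal

variable {p : ℕ} [Fact p.Prime] {k : Type u} [Field k] (𝒳 : SchemeOver (WittVector p k)) (n : ℕ)

/-- `i : X_{n+1} ⟶ X_{n+2}`, the transition map. -/
local notation3 "ι[" 𝒳 ", " n "]" => thickeningMap 𝒳 (Nat.le_succ (n + 1))

/-- `ρ : 𝒪_{X_{n+2}} ⟶ i_* j_* 𝒪_{X_k}`, restriction of functions to the special fibre. -/
local notation3 "ρ[" 𝒳 ", " n "]" =>
  (structureModuleMap ι[𝒳, n] ≫ (Scheme.Modules.pushforward ι[𝒳, n]).map
    (structureModuleMap (specialFibreToThickening 𝒳 n)) :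
    unitModule (thickening 𝒳 (n + 2)).left ⟶ (Scheme.Modules.pushforward ι[𝒳, n]).obj
      ((Scheme.Modules.pushforward (specialFibreToThickening 𝒳 n)).obj
        (unitModule (specialFibre 𝒳).left)))

/-- `p^{n+1} · i♯ = 0`: `p^{n+1} = 0` on `X_{n+1}` (F3). [folklore] -/
theorem nsmul_id_comp_structureModuleMap :
    ((p ^ (n + 1)) • 𝟙 (unitModule (thickening 𝒳 (n + 2)).left)) ≫ structureModuleMap ι[𝒳, n] =
      0 := by
  refine Scheme.Modules.hom_ext _ _ fun U => ?_
  ext a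
  change ι[𝒳, n].app U (((p ^ (n + 1)) • 𝟙 (unitModule (thickening 𝒳 (n + 2)).left)).app U a) = 0
  rw [nsmul_id_unit_app_apply, map_mul, map_natCast, natCast_pow_eq_zero_thickening, zero_mul]

variable [CharP k p]

/-- `ρ` on sections: `a ↦ j♯(i♯ a)` (definitional). [folklore] -/
theorem restrictToSpecial_app (U : (thickening 𝒳 (n + 2)).left.Opens)
    (a : Γ((thickening 𝒳 (n + 2)).left, U)) :
    (ρ[𝒳, n]).app U a = (specialFibreToThickening 𝒳 n).app (ι[𝒳, n] ⁻¹ᵁ U) (ι[𝒳, n].app U a) :=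
  rfl

/-- `ρ` is surjective on affine opens (`i♯`, `j♯` are, for the closed immersions `i`, `j`).
[folklore] -/
theorem restrictToSpecial_app_surjective {U : (thickening 𝒳 (n + 2)).left.Opens}
    (hU : IsAffineOpen U) : Function.Surjective ((ρ[𝒳, n]).app U) := by
  haveI := isClosedImmersion_thickeningMap 𝒳 (Nat.le_succ (n + 1))
  haveI := isClosedImmersion_specialFibreToThickening' 𝒳 n
  exact ((specialFibreToThickening 𝒳 n).app_surjective _ (hU.preimage ι[𝒳, n])).comp
    (ι[𝒳, n].app_surjective U hU)

/-- `ρ` is an epimorphism of `𝒪_{X_{n+2}}`-modules. [folklore] -/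
theorem epi_restrictToSpecial : Epi ρ[𝒳, n] :=
  epi_of_app_surjective_of_isAffineOpen _ fun _ hU => restrictToSpecial_app_surjective 𝒳 n hU

/-- `ρ` has a kernel (as every morphism of the abelian category `X_{n+2}.Modules`; recorded to
short-circuit instance search on the composite `ρ`). [folklore] -/
theorem hasKernel_restrictToSpecial : HasKernel ρ[𝒳, n] := HasKernels.has_limit _

attribute [local instance] hasKernel_restrictToSpecial

variable [PerfectRing k p]

/-- (B4, affine) If `a ∈ Γ(X_{n+2}, U)`, `U` affine, vanishes on `X_k`, then `p^{n+1} a = 0`: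
`a ∈ (p) + (p^{n+1})` by (F2), (F1), and `p^{n+2} = 0`. [folklore] -/
theorem pow_mul_eq_zero_of_restrictToSpecial_app_eq_zero {U : (thickening 𝒳 (n + 2)).left.Opens}
    (hU : IsAffineOpen U) (a : Γ((thickening 𝒳 (n + 2)).left, U)) (ha : (ρ[𝒳, n]).app U a = 0) :
    ((p ^ (n + 1) : ℕ) : Γ((thickening 𝒳 (n + 2)).left, U)) * a = 0 := by
  haveI := isClosedImmersion_thickeningMap 𝒳 (Nat.le_succ (n + 1))
  have h1 : ι[𝒳, n].app U a ∈ RingHom.ker ((specialFibreToThickening 𝒳 n).app _).hom := ha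
  obtain ⟨c', hc'⟩ := Ideal.mem_span_singleton'.mp
    (ker_app_specialFibreToThickening_le 𝒳 n (hU.preimage ι[𝒳, n]) h1)
  obtain ⟨c, rfl⟩ := ι[𝒳, n].app_surjective U hU c'
  have h2 : a - c * ((p ^ 1 : ℕ) :) ∈ RingHom.ker (ι[𝒳, n].app U).hom := by
    rw [RingHom.mem_ker, map_sub, map_mul, map_natCast]
    exact sub_eq_zero.mpr hc'.symm
  obtain ⟨e, he⟩ := Ideal.mem_span_singleton'.mp (ker_app_thickeningMap_le 𝒳 _ hU h2)
  have hp : ((p ^ (n + 2) : ℕ) : Γ((thickening 𝒳 (n + 2)).left, U)) = 0 :=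
    natCast_pow_eq_zero_thickening 𝒳 (n + 2) U
  calc ((p ^ (n + 1) : ℕ) : Γ((thickening 𝒳 (n + 2)).left, U)) * a
      = (p ^ (n + 1) : ℕ) * (c * (p ^ 1 : ℕ) + e * (p ^ (n + 1) : ℕ)) := by rw [he]; ring
    _ = (p ^ (n + 2) : ℕ) * c + (p ^ (n + 2) : ℕ) * ((p ^ n : ℕ) * e) := by push_cast; ring
    _ = 0 := by rw [hp, zero_mul, zero_mul, add_zero]

/-- **(B4) `ker ρ ≫ μ = 0`** (tested on affine opens, `hom_ext_of_isAffineOpen`). [folklore] -/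
theorem kernel_ι_comp_mulToIdeal :
    kernel.ι ρ[𝒳, n] ≫ kernel.lift (structureModuleMap ι[𝒳, n])
      ((p ^ (n + 1)) • 𝟙 (unitModule (thickening 𝒳 (n + 2)).left))
      (nsmul_id_comp_structureModuleMap 𝒳 n) = 0 := by
  rw [← cancel_mono (idealModuleι ι[𝒳, n]), Category.assoc, kernel.lift_ι, zero_comp]
  refine hom_ext_of_isAffineOpen _ _ fun U hU => ?_
  ext x
  change ((((p ^ (n + 1)) • 𝟙 (unitModule (thickening 𝒳 (n + 2)).left)).app U
    ((kernel.ι ρ[𝒳, n]).app U x) : Γ((thickening 𝒳 (n + 2)).left, U))) = 0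
  rw [nsmul_id_unit_app_apply]
  exact pow_mul_eq_zero_of_restrictToSpecial_app_eq_zero 𝒳 n hU _ (app_kernel_ι_app _ U x)

/-! #### A descent `ν` of `μ` along `ρ` is an isomorphism -/

section Desc

variable {𝒳 n}
  {ν : (Scheme.Modules.pushforward ι[𝒳, n]).obj
      ((Scheme.Modules.pushforward (specialFibreToThickening 𝒳 n)).obj
        (unitModule (specialFibre 𝒳).left)) ⟶ idealModule ι[𝒳, n]}
  (hν : ρ[𝒳, n] ≫ ν = kernel.lift (structureModuleMap ι[𝒳, n])
    ((p ^ (n + 1)) • 𝟙 (unitModule (thickening 𝒳 (n + 2)).left))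
    (nsmul_id_comp_structureModuleMap 𝒳 n))

include hν

omit [PerfectRing k p] in
/-- On sections: `(𝓘 ↪ 𝒪)(ν(ρ b)) = p^{n+1} b`. [folklore] -/
theorem ι_app_desc_app (U : (thickening 𝒳 (n + 2)).left.Opens)
    (b : Γ((thickening 𝒳 (n + 2)).left, U)) :
    (idealModuleι ι[𝒳, n]).app U (ν.app U ((ρ[𝒳, n]).app U b)) =
      ((p ^ (n + 1) : ℕ) : Γ((thickening 𝒳 (n + 2)).left, U)) * b := by
  rw [← comp_app_apply ρ[𝒳, n], ← comp_app_apply, hν, kernel.lift_ι, nsmul_id_unit_app_apply]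

/-- **`ν` is injective on affine opens** (flatness input (F4): `p^{n+1} b = 0 ⟹ b ∈ (p)`, and
`p = 0` on `X_k`). [folklore] -/
theorem desc_app_injective {d : ℕ} (h𝒳 : IsSmoothProperModel d 𝒳)
    {U : (thickening 𝒳 (n + 2)).left.Opens} (hU : IsAffineOpen U) :
    Function.Injective (ν.app U) := by
  refine (injective_iff_map_eq_zero _).mpr fun s hs => ?_
  obtain ⟨b, rfl⟩ : ∃ b : Γ((thickening 𝒳 (n + 2)).left, U), (ρ[𝒳, n]).app U b = s :=
    restrictToSpecial_app_surjective 𝒳 n hU s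
  have h0 : ((p ^ (n + 1) : ℕ) : Γ((thickening 𝒳 (n + 2)).left, U)) * b = 0 := by
    rw [← ι_app_desc_app hν, hs, map_zero]
    rfl
  obtain ⟨e, rfl⟩ := Ideal.mem_span_singleton'.mp
    (mem_span_p_of_pow_mul_eq_zero_thickening 𝒳 h𝒳 n hU b h0)
  rw [restrictToSpecial_app, map_mul, map_mul, map_natCast, map_natCast,
    natCast_eq_zero_specialFibre, mul_zero]
  rfl

omit [PerfectRing k p] in
/-- **`ν` is surjective on affine opens** ((F1): `ker i♯ ⊆ (p^{n+1})`). [folklore] -/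
theorem desc_app_surjective {U : (thickening 𝒳 (n + 2)).left.Opens} (hU : IsAffineOpen U) :
    Function.Surjective (ν.app U) := by
  intro x
  have hx : (idealModuleι ι[𝒳, n]).app U x ∈ RingHom.ker (ι[𝒳, n].app U).hom :=
    app_kernel_ι_app _ U x
  obtain ⟨b, hb⟩ := Ideal.mem_span_singleton'.mp (ker_app_thickeningMap_le 𝒳 _ hU hx)
  refine ⟨(ρ[𝒳, n]).app U b, kernel_ι_app_injective _ U ?_⟩
  rw [ι_app_desc_app hν, mul_comm, hb]

/-- **A descent `ν` of `μ` along `ρ` is an isomorphism** `i_* j_* 𝒪_{X_k} ≅ 𝓘` for a smooth proper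
model `𝒳/W(k)`, `k` perfect (`isIso_of_app_bijective_of_isAffineOpen`). [folklore] -/
theorem isIso_desc {d : ℕ} (h𝒳 : IsSmoothProperModel d 𝒳) : IsIso ν :=
  isIso_of_app_bijective_of_isAffineOpen _ fun _ hU =>
    ⟨desc_app_injective hν h𝒳 hU, desc_app_surjective hν hU⟩

end Desc

/-- **Stub G3 of line `sigma-ob-kzero-additivity`** (registered form): for `k` perfect of
characteristic `p`, a smooth proper model `𝒳/W(k)` and every `n`, the conormal sheaf of the
first-order thickening `i : X_{n+1} ↪ X_{n+2}` is `j_*𝒪_{X_k}`, `j : X_k ↪ X_{n+1}`: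
`i^*𝓘 ≅ i^*(i_*(j_*𝒪)) ≅ j_*𝒪` by the descent `ν : i_* j_* 𝒪 ⥲ 𝓘` of multiplication by `p^{n+1}`
(`isIso_desc`, Mathlib `Abelian.epiDesc`) and the counit isomorphism of the closed immersion `i`
(`isIso_counit_app_of_isClosedImmersion`). [folklore] -/
theorem stub_conormalSheaf_thickeningMap :
  ∀ (p : ℕ) [Fact p.Prime] (k : Type) [Field k] [CharP k p] [PerfectRing k p] (d : ℕ)
    (𝒳 : SchemeOver (WittVector p k)), IsSmoothProperModel d 𝒳 → ∀ (n : ℕ),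
      Nonempty (conormalSheaf (thickeningMap 𝒳 (Nat.le_succ (n + 1))) ≅
        (Scheme.Modules.pushforward (specialFibreToThickening 𝒳 n)).obj
          (unitModule (specialFibre 𝒳).left)) := by
  intro p _ k _ _ _ d 𝒳 h𝒳 n
  haveI := epi_restrictToSpecial 𝒳 n
  haveI := isClosedImmersion_thickeningMap 𝒳 (Nat.le_succ (n + 1))
  -- the descent `ν` of `μ = p^{n+1}·` along the epimorphism `ρ`, an isomorphism `i_* j_* 𝒪 ⥲ 𝓘`
  obtain ⟨ν, hν⟩ : ∃ ν, ρ[𝒳, n] ≫ ν = kernel.lift (structureModuleMap ι[𝒳, n])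
      ((p ^ (n + 1)) • 𝟙 (unitModule (thickening 𝒳 (n + 2)).left))
      (nsmul_id_comp_structureModuleMap 𝒳 n) :=
    ⟨_, Abelian.comp_epiDesc _ _ (kernel_ι_comp_mulToIdeal 𝒳 n)⟩
  haveI := isIso_desc hν h𝒳
  -- `i^*𝓘 ≅ i^*(i_* j_* 𝒪) ≅ j_* 𝒪` (counit of the closed immersion `i`)
  have e : (Scheme.Modules.pullback ι[𝒳, n]).obj ((Scheme.Modules.pushforward ι[𝒳, n]).obj
      ((Scheme.Modules.pushforward (specialFibreToThickening 𝒳 n)).obj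
        (unitModule (specialFibre 𝒳).left))) ≅
      (Scheme.Modules.pushforward (specialFibreToThickening 𝒳 n)).obj
        (unitModule (specialFibre 𝒳).left) :=
    @asIso _ _ _ _ _ (isIso_counit_app_of_isClosedImmersion ι[𝒳, n]
      ((Scheme.Modules.pushforward (specialFibreToThickening 𝒳 n)).obj
        (unitModule (specialFibre 𝒳).left)))
  exact ⟨(Scheme.Modules.pullback ι[𝒳, n]).mapIso (asIso ν).symm ≪≫ e⟩

end Ideal

end Summit.HodgeConjecture.HodgeConjecture.Theorems.PadicPridhamSemiregularity

end
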